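import Summits.QuantumFields.BalabanUV.T4Continuum.Support.NE7K1LinTorusSymbolStrip

/-!
# NE7K1LinTorusSymbolStripDeriv — row NE7 (node U5), candidate route HOM, path H1L, cell K1-lin(s): B-E1's CLAUSE (e′) ON THE
# FINITE TORUS — the DERIVATIVE SUMS of the complexified symbol (weights `v_μ`, `v_μv_ν`, any weight `≤ B·e^{δ|v|_∞}`) are bounded in
# the strip `Σ_μ|Im k_μ| ≤ η`, `η + δ < θ`, UNIFORMLY IN THE TORUS SIZE (NEEDS-ESTIMATE #E1, B-E1 (e′))

Lineage `b2b-balaban-t4-ne7-p2` (CRUX PROVER NE7 #2), generation 73; file 46.  File 45 (`NE7K1LinTorusSymbolStrip`) bounded the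
complexified symbol `Σ_y T^𝕋(s)(c₀,y)·e^{ik·(y−c₀)}` in the strip; the desk's E-57 (F1) census lists, besides (a′)–(d′), the clause
(e′) «C² bounds» — bounds on the `k`-derivatives.  On a finite torus the `m`-th partial derivatives of the symbol are the finite sums with
the polynomial weights `Π (i·(y−c₀)_μ)`; THIS FILE bounds every such WEIGHTED sum:

* §1 polynomial weights are exponentially small change: `x ≤ δ⁻¹e^{δx}`, `x² ≤ 2δ⁻²e^{δx}` (`le_inv_mul_exp`, `sq_le_inv_sq_mul_exp`),
  so `|(y−c₀)_μ| ≤ δ⁻¹e^{δ|y−c₀|_∞}` and `|(y−c₀)_μ(y−c₀)_ν| ≤ 2δ⁻²e^{δ|y−c₀|_∞}`.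
* §2 **`norm_weightedSymb_le`**: for any weight `w` with `‖w(y)‖ ≤ B·e^{δ|y−c₀|_∞}` (`B, δ ≥ 0`), `0 ≤ η`, `η + δ < θ`, θ admissible
  (file 28's `16(d+1)²L^{d+3}(e^θ − 1) ≤ 1`), `s ∈ [0,1]` and every complex `k` with `Σ_μ|Im k_μ| ≤ η`:
  `‖Σ_y T^𝕋(s)(c₀,y)·w(y)·exp(iΣ_μ k_μ(y−c₀)_μ)‖ ≤ 2n²C_𝕋·e^{2θ}·B·((1+e^{−κ′})∕(1−e^{−κ′}))^{d+1}`, `κ′ = (θ−η−δ)∕(d+1)` — uniform in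
  the size; **`norm_torSymbC_deriv_le`** (weight `i(y−c₀)_μ`, `B = δ⁻¹`) and **`norm_torSymbC_deriv2_le`** (weight `−(y−c₀)_μ(y−c₀)_ν`,
  `B = 2δ⁻²`) are the first- and second-derivative sums = clause (e′).

HONEST FRAMING: [folklore] (finite weighted Paley–Wiener estimates); `a = 0`, U = 1, ONE scale; crude explicit constants; the sums are
stated as sums (their identification with `∂_{k_μ}`, `∂²_{k_μk_ν}` of the finite exponential sum is immediate and left to the consumer);
R-E1 untouched; nothing of Bałaban's asserted; no `sorry`.  Census only (B-E1 (e′) on the finite doubled torus of every size); NE7 NOT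
PRINTED ∕ NOT PROVED; spine 0∕9; FIXED FINITE T⁴, rung (B)+1; NOT infinite volume, NOT mass gap, NOT Clay.  HONEST DEPENDENCY:
continuum YM on T⁴ ⇐ BetaPertH ∧ nine spine estimates (0/9 proved); BetaPertH ⇐ (D1) ∧ (D4) ∧ CAP+tail; G-an2-4 gates asym, D1 and
NE2/3/4.
-/

noncomputable section

open Finset Matrix Complex

namespace Summit.QuantumFields.BalabanUV.T4Continuum.NE7K1LinTorusSymbolStripDeriv

open Literature.MathematicalPhysics.QuantumFieldTheory.Balaban1983to89
open Literature.MathematicalPhysics.QuantumFieldTheory.Balaban1983to89.B4ContourShift (supNorm supNorm_nonneg abs_le_supNorm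
  exists_supNorm_eq)
open Literature.MathematicalPhysics.QuantumFieldTheory.Balaban1983to89.B4Reflection242
open Literature.MathematicalPhysics.QuantumFieldTheory.Balaban1983to89.B4Lower18
open Literature.MathematicalPhysics.QuantumFieldTheory.Balaban1983to89.B4TorusPositivity (wrap wrap_wrap_add)
open NE7K1LinFoldKernels NE7K1LinFoldMatrices NE7K1LinSchurFold NE7K1LinTorusChart NE7K1LinSchurFoldBox
  NE7K1LinTorusLineInvariant NE7K1LinTorusLineSymbol NE7K1LinTorusSymbolReal NE7K1LinTorusJensen NE7K1LinTorusFloor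
  NE7K1LinTorusEntries NE7K1LinTorusFluctDecay NE7K1LinTorusKernelDecay NE7K1LinTorusSymbolStrip NE7K1LinSchurLineU1

variable {d : ℕ}

/-! ### §1 Polynomial weights cost an arbitrarily small exponential rate -/

/-- `x ≤ δ⁻¹·e^{δx}` (`δ > 0`). [folklore] -/
theorem le_inv_mul_exp {δ : ℝ} (hδ : 0 < δ) (x : ℝ) : x ≤ δ⁻¹ * Real.exp (δ * x) := by
  have h := Real.add_one_le_exp (δ * x)
  rw [le_inv_mul_iff₀ hδ]
  nlinarith

/-- `x² ≤ 2δ⁻²·e^{δx}` for `x ≥ 0`, `δ > 0` (`e^t ≥ 1 + t + t²∕2`). [folklore] -/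
theorem sq_le_inv_sq_mul_exp {δ x : ℝ} (hδ : 0 < δ) (hx : 0 ≤ x) : x ^ 2 ≤ 2 * (δ ^ 2)⁻¹ * Real.exp (δ * x) := by
  have ht : 0 ≤ δ * x := mul_nonneg hδ.le hx
  have h : (δ * x) ^ 2 / 2 ≤ Real.exp (δ * x) := by
    have := Real.quadratic_le_exp_of_nonneg ht
    nlinarith [this]
  have hδ2 : 0 < δ ^ 2 := pow_pos hδ 2
  rw [show 2 * (δ ^ 2)⁻¹ * Real.exp (δ * x) = (2 * Real.exp (δ * x)) / δ ^ 2 by field_simp, le_div_iff₀ hδ2]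
  nlinarith [h]

/-! ### §2 Weighted symbol sums in the strip -/

section Weighted

variable {n L : ℕ} [NeZero L] {M : Fin (d + 1) → ℕ}

/-- **WEIGHTED PALEY–WIENER ON THE TORUS**: for a weight `w` with `‖w(y)‖ ≤ B·e^{δ|y − c₀|_∞}`, `0 ≤ η`, `0 ≤ δ`, `η + δ < θ` with
file 28's rate condition, every `s ∈ [0,1]` and every complex `k` with `Σ_μ|Im k_μ| ≤ η`:
`‖Σ_y T^𝕋(s)(c₀,y)·w(y)·exp(iΣ_μ k_μ(y − c₀)_μ)‖ ≤ 2n²C_𝕋·e^{2θ}·B·((1 + e^{−κ′})∕(1 − e^{−κ′}))^{d+1}`, `κ′ = (θ − η − δ)∕(d+1)`. [folklore] -/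
theorem norm_weightedSymb_le (hn : 1 ≤ n) (hM : ∀ i, 1 ≤ M i) {θ η δ B : ℝ} (hη : 0 ≤ η) (hδ : 0 ≤ δ) (hB : 0 ≤ B)
    (hηθ : η + δ < θ) (hθs : 16 * ((d : ℝ) + 1) ^ 2 * (L : ℝ) ^ (d + 3) * (Real.exp θ - 1) ≤ 1) {s : ℝ} (hs0 : 0 ≤ s)
    (hs1 : s ≤ 1) (k : Fin (d + 1) → ℂ) (hk : ∑ μ : Fin (d + 1), |(k μ).im| ≤ η)
    (w : ↥((boxDom (dbl fun i => n * L * M i)).image (blk L)) → ℂ)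
    (hw : ∀ y, ‖w y‖ ≤ B * Real.exp (δ * supNorm (y.1 - fun i => ((n * M i : ℕ) : ℤ)))) :
    ‖∑ y : ↥((boxDom (dbl fun i => n * L * M i)).image (blk L)),
        (torLine (isBlockUnion_fine (fineTor_isBlockUnion hn (NeZero.one_le : 1 ≤ L) M)) n 0 (fun i => n * L * M i)
            (fun i => n * M i) s ⟨fun i => ((n * M i : ℕ) : ℤ), ctr_mem_labels hn hM⟩ y : ℂ) * w y *
          Complex.exp (Complex.I * ∑ μ : Fin (d + 1), k μ * (((y.1 μ - ((n * M μ : ℕ) : ℤ) : ℤ)) : ℂ))‖ ≤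
      2 * ((n : ℝ) ^ 2 * (64 * ((d : ℝ) + 1) ^ 2 * (2 * (d : ℝ) + 3) ^ 2 * (L : ℝ) ^ (d + 5))) * Real.exp (2 * θ) * B *
        ((1 + Real.exp (-((θ - η - δ) / ((d : ℝ) + 1)))) / (1 - Real.exp (-((θ - η - δ) / ((d : ℝ) + 1))))) ^ (d + 1) := by
  classical
  have hL : 1 ≤ L := NeZero.one_le
  have hK : ∀ i, 1 ≤ (fun i => n * M i) i := mul_pos_side hn hM
  have hθ : 0 ≤ θ := by linarith
  set C : ℝ := (n : ℝ) ^ 2 * (64 * ((d : ℝ) + 1) ^ 2 * (2 * (d : ℝ) + 3) ^ 2 * (L : ℝ) ^ (d + 5)) with hC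
  have hC0 : 0 ≤ C := by rw [hC]; positivity
  set c₀ : ↥((boxDom (dbl fun i => n * L * M i)).image (blk L)) := ⟨fun i => ((n * M i : ℕ) : ℤ), ctr_mem_labels hn hM⟩ with hc₀
  -- termwise: `|T(c₀,y)|·‖w y‖·|plane wave| ≤ 2C e^{−θ(ρ−2)}·B e^{δρ}·e^{ηρ} = 2C e^{2θ} B e^{−(θ−η−δ)ρ}`
  have hterm : ∀ y : ↥((boxDom (dbl fun i => n * L * M i)).image (blk L)),
      ‖(torLine (isBlockUnion_fine (fineTor_isBlockUnion hn hL M)) n 0 (fun i => n * L * M i) (fun i => n * M i) s c₀ y : ℂ) * w y *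
          Complex.exp (Complex.I * ∑ μ : Fin (d + 1), k μ * (((y.1 μ - ((n * M μ : ℕ) : ℤ) : ℤ)) : ℂ))‖ ≤
        2 * C * Real.exp (2 * θ) * B * Real.exp (-((θ - η - δ) * supNorm (y.1 - fun i => ((n * M i : ℕ) : ℤ)))) := by
    intro y
    set ρ := supNorm (y.1 - fun i => ((n * M i : ℕ) : ℤ)) with hρ
    rw [norm_mul, norm_mul, Complex.norm_real, Real.norm_eq_abs]
    have hT : |torLine (isBlockUnion_fine (fineTor_isBlockUnion hn hL M)) n 0 (fun i => n * L * M i) (fun i => n * M i) s c₀ y| ≤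
        2 * C * Real.exp (-(θ * (ρ - 2))) := by
      rw [← (torLine_isSymm _ rfl (image_fineTor hL n M) n 0 s).apply c₀ y]
      exact torLine_entry_decay_ctr (K := fun i => n * M i) (Nf := fun i => n * L * M i) hn hK (side_eq n L M) rfl
        (fineTor_isBlockUnion hn hL M) hθ hθs hs0 hs1 y c₀ rfl
    have hW' : ‖Complex.exp (Complex.I * ∑ μ : Fin (d + 1), k μ * (((y.1 μ - ((n * M μ : ℕ) : ℤ) : ℤ)) : ℂ))‖ ≤
        Real.exp (η * ρ) := by
      refine (le_of_eq ?_).trans ((norm_exp_I_mul_sum_le k (y.1 - fun i => ((n * M i : ℕ) : ℤ))).trans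
        (Real.exp_le_exp.2 (mul_le_mul_of_nonneg_right hk (supNorm_nonneg _))))
      rfl
    have hwy := hw y
    have h1 : |torLine (isBlockUnion_fine (fineTor_isBlockUnion hn hL M)) n 0 (fun i => n * L * M i) (fun i => n * M i) s c₀ y| *
        ‖w y‖ ≤ (2 * C * Real.exp (-(θ * (ρ - 2)))) * (B * Real.exp (δ * ρ)) :=
      mul_le_mul hT hwy (norm_nonneg _) (by positivity)
    calc |torLine (isBlockUnion_fine (fineTor_isBlockUnion hn hL M)) n 0 (fun i => n * L * M i) (fun i => n * M i) s c₀ y| *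
          ‖w y‖ * ‖Complex.exp (Complex.I * ∑ μ : Fin (d + 1), k μ * (((y.1 μ - ((n * M μ : ℕ) : ℤ) : ℤ)) : ℂ))‖
        ≤ (2 * C * Real.exp (-(θ * (ρ - 2)))) * (B * Real.exp (δ * ρ)) * Real.exp (η * ρ) :=
          mul_le_mul h1 hW' (norm_nonneg _) (by positivity)
      _ = 2 * C * Real.exp (2 * θ) * B * Real.exp (-((θ - η - δ) * ρ)) := by
          have e : Real.exp (-(θ * (ρ - 2))) * Real.exp (δ * ρ) * Real.exp (η * ρ) =
              Real.exp (2 * θ) * Real.exp (-((θ - η - δ) * ρ)) := by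
            rw [← Real.exp_add, ← Real.exp_add, ← Real.exp_add]; congr 1; ring
          calc (2 * C * Real.exp (-(θ * (ρ - 2)))) * (B * Real.exp (δ * ρ)) * Real.exp (η * ρ)
              = 2 * C * B * (Real.exp (-(θ * (ρ - 2))) * Real.exp (δ * ρ) * Real.exp (η * ρ)) := by ring
            _ = 2 * C * Real.exp (2 * θ) * B * Real.exp (-((θ - η - δ) * ρ)) := by rw [e]; ring
  refine (norm_sum_le _ _).trans ((Finset.sum_le_sum fun y _ => hterm y).trans ?_)
  rw [← Finset.mul_sum]
  refine mul_le_mul_of_nonneg_left ?_ (by positivity)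
  have hκ : 0 < θ - η - δ := by linarith
  refine le_trans (le_of_eq ?_) (sum_exp_neg_supNorm_le hκ (fun i => n * M i))
  refine Fintype.sum_equiv
    { toFun := fun y => ⟨y.1, mem_dbl_of_mem_image (L := L) y.2⟩
      invFun := fun x => ⟨x.1, mem_image_of_mem_dbl (L := L) x.2⟩
      left_inv := fun y => Subtype.ext rfl
      right_inv := fun x => Subtype.ext rfl } _ _ fun y => ?_
  rfl

omit [NeZero L] in
/-- a coordinate of `y − c₀` is at most `δ⁻¹e^{δ|y − c₀|_∞}` in modulus (`δ > 0`). [folklore] -/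
theorem norm_coord_le {δ : ℝ} (hδ : 0 < δ) (y : ↥((boxDom (dbl fun i => n * L * M i)).image (blk L)))
    (μ : Fin (d + 1)) :
    ‖(Complex.I * (((y.1 μ - ((n * M μ : ℕ) : ℤ) : ℤ)) : ℂ))‖ ≤ δ⁻¹ * Real.exp (δ * supNorm (y.1 - fun i => ((n * M i : ℕ) : ℤ))) := by
  rw [norm_mul, Complex.norm_I, one_mul, Complex.norm_intCast]
  have h1 : |(((y.1 μ - ((n * M μ : ℕ) : ℤ) : ℤ)) : ℝ)| ≤ supNorm (y.1 - fun i => ((n * M i : ℕ) : ℤ)) := by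
    have := abs_le_supNorm (y.1 - fun i => ((n * M i : ℕ) : ℤ)) μ
    rwa [Int.cast_abs, Pi.sub_apply] at this
  exact h1.trans (le_inv_mul_exp hδ _)

omit [NeZero L] in
/-- a product of two coordinates of `y − c₀` is at most `2δ⁻²e^{δ|y − c₀|_∞}` in modulus (`δ > 0`). [folklore] -/
theorem norm_coord_mul_coord_le {δ : ℝ} (hδ : 0 < δ) (y : ↥((boxDom (dbl fun i => n * L * M i)).image (blk L)))
    (μ ν : Fin (d + 1)) :
    ‖(-((((y.1 μ - ((n * M μ : ℕ) : ℤ) : ℤ)) : ℂ) * (((y.1 ν - ((n * M ν : ℕ) : ℤ) : ℤ)) : ℂ)))‖ ≤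
      2 * (δ ^ 2)⁻¹ * Real.exp (δ * supNorm (y.1 - fun i => ((n * M i : ℕ) : ℤ))) := by
  set ρ := supNorm (y.1 - fun i => ((n * M i : ℕ) : ℤ)) with hρ
  rw [norm_neg, norm_mul, Complex.norm_intCast, Complex.norm_intCast]
  have h1 : ∀ τ : Fin (d + 1), |(((y.1 τ - ((n * M τ : ℕ) : ℤ) : ℤ)) : ℝ)| ≤ ρ := fun τ => by
    have := abs_le_supNorm (y.1 - fun i => ((n * M i : ℕ) : ℤ)) τ
    rwa [Int.cast_abs, Pi.sub_apply] at this
  have hρ0 : 0 ≤ ρ := supNorm_nonneg _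
  calc |(((y.1 μ - ((n * M μ : ℕ) : ℤ) : ℤ)) : ℝ)| * |(((y.1 ν - ((n * M ν : ℕ) : ℤ) : ℤ)) : ℝ)| ≤ ρ * ρ :=
        mul_le_mul (h1 μ) (h1 ν) (abs_nonneg _) hρ0
    _ = ρ ^ 2 := by ring
    _ ≤ 2 * (δ ^ 2)⁻¹ * Real.exp (δ * ρ) := sq_le_inv_sq_mul_exp hδ hρ0

/-- **B-E1 (e′), FIRST DERIVATIVES**: the `∂_{k_μ}`-sum of the complexified symbol (weight `i(y − c₀)_μ`) is bounded in the strip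
`Σ|Im k_λ| ≤ η`, `η + δ < θ`, by `2n²C_𝕋·e^{2θ}·δ⁻¹·((1+e^{−κ′})∕(1−e^{−κ′}))^{d+1}`, `κ′ = (θ−η−δ)∕(d+1)` — uniform in the torus size.
[folklore] -/
theorem norm_torSymbC_deriv_le (hn : 1 ≤ n) (hM : ∀ i, 1 ≤ M i) {θ η δ : ℝ} (hη : 0 ≤ η) (hδ : 0 < δ) (hηθ : η + δ < θ)
    (hθs : 16 * ((d : ℝ) + 1) ^ 2 * (L : ℝ) ^ (d + 3) * (Real.exp θ - 1) ≤ 1) {s : ℝ} (hs0 : 0 ≤ s) (hs1 : s ≤ 1)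
    (k : Fin (d + 1) → ℂ) (hk : ∑ μ : Fin (d + 1), |(k μ).im| ≤ η) (μ : Fin (d + 1)) :
    ‖∑ y : ↥((boxDom (dbl fun i => n * L * M i)).image (blk L)),
        (torLine (isBlockUnion_fine (fineTor_isBlockUnion hn (NeZero.one_le : 1 ≤ L) M)) n 0 (fun i => n * L * M i)
            (fun i => n * M i) s ⟨fun i => ((n * M i : ℕ) : ℤ), ctr_mem_labels hn hM⟩ y : ℂ) *
          (Complex.I * (((y.1 μ - ((n * M μ : ℕ) : ℤ) : ℤ)) : ℂ)) *
          Complex.exp (Complex.I * ∑ τ : Fin (d + 1), k τ * (((y.1 τ - ((n * M τ : ℕ) : ℤ) : ℤ)) : ℂ))‖ ≤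
      2 * ((n : ℝ) ^ 2 * (64 * ((d : ℝ) + 1) ^ 2 * (2 * (d : ℝ) + 3) ^ 2 * (L : ℝ) ^ (d + 5))) * Real.exp (2 * θ) * δ⁻¹ *
        ((1 + Real.exp (-((θ - η - δ) / ((d : ℝ) + 1)))) / (1 - Real.exp (-((θ - η - δ) / ((d : ℝ) + 1))))) ^ (d + 1) :=
  norm_weightedSymb_le hn hM hη hδ.le (inv_pos.2 hδ).le hηθ hθs hs0 hs1 k hk _ (fun y => norm_coord_le (L := L) hδ y μ)

/-- **B-E1 (e′), SECOND DERIVATIVES**: the `∂²_{k_μk_ν}`-sum (weight `−(y − c₀)_μ(y − c₀)_ν`) is bounded in the same strip by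
`2n²C_𝕋·e^{2θ}·2δ⁻²·((1+e^{−κ′})∕(1−e^{−κ′}))^{d+1}` — uniform in the torus size. [folklore] -/
theorem norm_torSymbC_deriv2_le (hn : 1 ≤ n) (hM : ∀ i, 1 ≤ M i) {θ η δ : ℝ} (hη : 0 ≤ η) (hδ : 0 < δ) (hηθ : η + δ < θ)
    (hθs : 16 * ((d : ℝ) + 1) ^ 2 * (L : ℝ) ^ (d + 3) * (Real.exp θ - 1) ≤ 1) {s : ℝ} (hs0 : 0 ≤ s) (hs1 : s ≤ 1)
    (k : Fin (d + 1) → ℂ) (hk : ∑ μ : Fin (d + 1), |(k μ).im| ≤ η) (μ ν : Fin (d + 1)) :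
    ‖∑ y : ↥((boxDom (dbl fun i => n * L * M i)).image (blk L)),
        (torLine (isBlockUnion_fine (fineTor_isBlockUnion hn (NeZero.one_le : 1 ≤ L) M)) n 0 (fun i => n * L * M i)
            (fun i => n * M i) s ⟨fun i => ((n * M i : ℕ) : ℤ), ctr_mem_labels hn hM⟩ y : ℂ) *
          (-((((y.1 μ - ((n * M μ : ℕ) : ℤ) : ℤ)) : ℂ) * (((y.1 ν - ((n * M ν : ℕ) : ℤ) : ℤ)) : ℂ))) *
          Complex.exp (Complex.I * ∑ τ : Fin (d + 1), k τ * (((y.1 τ - ((n * M τ : ℕ) : ℤ) : ℤ)) : ℂ))‖ ≤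
      2 * ((n : ℝ) ^ 2 * (64 * ((d : ℝ) + 1) ^ 2 * (2 * (d : ℝ) + 3) ^ 2 * (L : ℝ) ^ (d + 5))) * Real.exp (2 * θ) *
        (2 * (δ ^ 2)⁻¹) *
        ((1 + Real.exp (-((θ - η - δ) / ((d : ℝ) + 1)))) / (1 - Real.exp (-((θ - η - δ) / ((d : ℝ) + 1))))) ^ (d + 1) :=
  norm_weightedSymb_le hn hM hη hδ.le (by positivity) hηθ hθs hs0 hs1 k hk _
    (fun y => norm_coord_mul_coord_le (L := L) hδ y μ ν)

end Weighted

end Summit.QuantumFields.BalabanUV.T4Continuum.NE7K1LinTorusSymbolStripDeriv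

end
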